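/-
Copyright (c) 2026 the pub-hodgecm-mathlib formalisation cell (harness21).  Prover seat hodgecm-mathlib-LH7-p10 (g0), req620 Track A «(D-RAM) FOUR-FRAME» squad
(STAGE-1b, row (2) of the piece `f_{T₊}`, the (β₂) road (R-36), RamM rows (K-*): LH4-p16 (g0) 16:52:28Z «the RamM DICTIONARY step — valuation bookkeeping of
`D₀ = ϖE^j(α − ρα)ΘY` per cell → LH7-p10»; sequel of ★ p861491 ∕ p861408), 2026-09-04.
-/
import Summits.HodgeConjecture.HodgeConjecture.Theorems.F0P3cDyRamToricCensusDefs        -- ★ DEFS: `dualGen`, `levelSet`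
import Literature.NumberTheory.Automorphic.UnitaryThreeFourFrameDefs                     -- ★ `IsRamifiedQuadraticDatum`
import HarnessLib

/-!
# Crux `H413`, line LH4 «(D-RAM) FOUR-FRAME» — STAGE-1b, row (2), the (β₂) road: «THE SCALE DICTIONARY OF A CONE CELL» — the valuation of the cell scalar
# `D₀ = c·(α − ρα)·Θ(Y)` (`c = ϖE^j` the conductor, `Y = dualGen` the dual generator of level `a`) in the RamM and in the M∕E-unramified letters

Cell `hodgecm-mathlib` (D-0151), FLOOR 0, crux item H413 = `stmt-HodgeConjecture-24833`, route of record `HCCMUnconditional`; squad F0∕P3c∕LH4; lane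
`--supports stmt-HodgeConjecture-24833 --as helper` (count-neutral; pays NO tier-0 row).  THEOREMS ONLY (no `def`, no instance, no notation, no `sorry`, default heartbeats);
★-only imports; states NO law.

WHY (LH4-p16 (g0) 16:52:28Z, (κ-b) chain: ★ p861653 ray-domination + ★-cand `…RayScalarBoundaryTerm` + LH4-p15's S3″ + ★ p861861, «modulo the RamM DICTIONARY step»; LH4-p19 (g0)
★ p861637 letters `hylev ∕ hccv`).  The (L-K)∕(L-D×) heads scale the census letter of a cone cell by the scalar `D₀ := c·(α − ρα)·Θ(Y)`, `c = ϖE^j`, `Y = dualGen ρ Θ α c h x₀` the dual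
generator of a presented member `x₀·𝒪_j` of `levelSet ρ Θ α ϖE h j a` (level clause `|Y| = |ϖE|^a`).  THIS FILE is the one-line valuation bookkeeping of `D₀` per lane, so that the
cell instances (RamM `D = (a + s0 − 1, a)`, `K₀ = (a + s0, a)`; RamK∕Unr-K any `(j, a)`) are BY NAME:
* §1 RamM letters (★ T5c: `α := ϖM`, ρ-datum `(ρ, ϖM, d_ρ)` so `|ϖM| = exp(−1)`, `|ϖM − ρϖM| = |ϖM|^{d_ρ}`; `|ϖE| = exp(−2)`; `Θ` isometric):
  `v_cellScalar_ramM : |ϖE^j·(ϖM − ρϖM)·Θ Y| = exp(−(2j + 2a + d_ρ))` and the inverse form `exp(2j + 2a + d_ρ)`.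
* §2 M∕E-unramified letters (★ T5a∕T5b: `|α − ρα| = 1`, `|ϖE| = exp(−1)`): `v_cellScalar_unr : |ϖE^j·(α − ρα)·Θ Y| = exp(−(j + a))` and the inverse form.
NOT CLAIMED: anything about labels, rays, or which cells are dominated (LH4-p16 ∕ LH4-p19 ∕ LH4-p15 rows).
HONEST LABEL.  Count-neutral valuation bookkeeping; nothing printed is asserted; (β₂) the LETTER UNPROVED; `HC_CM` is proved only modulo the 7 printed citations (2 remaining named inputs:
hLiu418 = `stmt-HodgeConjecture-24832`, h413 = `stmt-HodgeConjecture-24833`) until rung 0 closes.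
## References
* [Jacobowitz1962] R. Jacobowitz, *Hermitian forms over local fields*, Amer. J. Math. 84 (1962), §4 (dual lattices, modular components).
* [Serre1979] J.-P. Serre, *Local Fields*, GTM 67 (1979), Ch. II §1 (discrete valuations); Ch. IV §1 (ramification of an involution).
* [Kottwitz1986BaseChangeUnits] R. E. Kottwitz, *Base change for unit elements of Hecke algebras*, Compositio Math. 60 (1986), §1 pp. 240–241.
-/

set_option autoImplicit false

noncomputable section

open WithZero
open scoped Valued
open Literature.NumberTheory.Automorphic.UnitaryThreeFourFrame (IsRamifiedQuadraticDatum)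
open Summit.HodgeConjecture.HodgeConjecture.Cruxes.H413.F0P3cDyRamToricCensusDefs

namespace Summit.HodgeConjecture.HodgeConjecture.Cruxes.H413.F0P3cDyRamConeCellScaleDictionary

variable {K : Type} [Field K] [Valued K ℤᵐ⁰] {ρ Θ : K →+* K}

/-! ## §1 RamM letters -/

/-- **THE CELL SCALAR IN THE RamM LETTERS**: for the ρ-datum `(ρ, ϖM, d_ρ)` (`|ϖM| = exp(−1)`, `|ϖM − ρϖM| = |ϖM|^{d_ρ}`), `|ϖE| = exp(−2)`, `Θ` isometric, and a dual generator `Y`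
of level `a` (`|Y| = |ϖE|^a`): `|ϖE^j · (ϖM − ρϖM) · Θ Y| = exp(−(2j + 2a + d_ρ))`.  (RamM cells: `D = (a + s0 − 1, a)` ↦ `exp(−(4a + 2s0 − 2 + d_ρ))`, `K₀ = (a + s0, a)` ↦
`exp(−(4a + 2s0 + d_ρ))`.) [cite: Jacobowitz1962, §4] [cite: Serre1979, Ch. II §1; Ch. IV §1] -/
theorem v_cellScalar_ramM {ϖM ϖE Y : K} {dρ t : ℕ} (hDρ : IsRamifiedQuadraticDatum ρ ϖM dρ t)
    (hvΘ : ∀ x, Valued.v (Θ x) = Valued.v x) (hϖE : Valued.v ϖE = exp (-2 : ℤ))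
    {j a : ℕ} (hY : Valued.v Y = Valued.v ϖE ^ a) :
    Valued.v (ϖE ^ j * (ϖM - ρ ϖM) * Θ Y) = exp (-(2 * (j : ℤ) + 2 * a + dρ)) := by
  have hϖM : Valued.v ϖM = exp (-1 : ℤ) := hDρ.2.2.1
  have hdat : Valued.v (ϖM - ρ ϖM) = Valued.v ϖM ^ dρ := hDρ.2.2.2.2.1
  rw [map_mul, map_mul, hvΘ, hY, map_pow, hdat, hϖE, hϖM, ← exp_nsmul, ← exp_nsmul, ← exp_nsmul, ← exp_add, ← exp_add]
  congr 1
  simp only [nsmul_eq_mul]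
  ring

/-- The same scalar on a presented member of a RamM cone cell `levelSet ρ Θ ϖM ϖE h j a` (dual generator `dualGen ρ Θ ϖM (ϖE^j) h x₀`, level clause `|Y| = |ϖE|^a`).
[cite: Jacobowitz1962, §4] [cite: Kottwitz1986BaseChangeUnits, §1 pp. 240–241] -/
theorem v_cellScalar_dualGen_ramM {ϖM ϖE h x₀ : K} {dρ t : ℕ} (hDρ : IsRamifiedQuadraticDatum ρ ϖM dρ t)
    (hvΘ : ∀ x, Valued.v (Θ x) = Valued.v x) (hϖE : Valued.v ϖE = exp (-2 : ℤ))
    {j a : ℕ} (hya : Valued.v (dualGen ρ Θ ϖM (ϖE ^ j) h x₀) = Valued.v ϖE ^ a) :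
    Valued.v (ϖE ^ j * (ϖM - ρ ϖM) * Θ (dualGen ρ Θ ϖM (ϖE ^ j) h x₀)) = exp (-(2 * (j : ℤ) + 2 * a + dρ)) :=
  v_cellScalar_ramM hDρ hvΘ hϖE hya

/-- The inverse RamM cell scalar: `|(ϖE^j · (ϖM − ρϖM) · Θ Y)⁻¹| = exp(2j + 2a + d_ρ)` (the scale by which the (L-K) heads divide). [cite: Jacobowitz1962, §4] [cite: Serre1979, Ch. II §1] -/
theorem v_cellScalar_inv_ramM {ϖM ϖE Y : K} {dρ t : ℕ} (hDρ : IsRamifiedQuadraticDatum ρ ϖM dρ t)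
    (hvΘ : ∀ x, Valued.v (Θ x) = Valued.v x) (hϖE : Valued.v ϖE = exp (-2 : ℤ))
    {j a : ℕ} (hY : Valued.v Y = Valued.v ϖE ^ a) :
    Valued.v (ϖE ^ j * (ϖM - ρ ϖM) * Θ Y)⁻¹ = exp (2 * (j : ℤ) + 2 * a + dρ) := by
  rw [map_inv₀, v_cellScalar_ramM hDρ hvΘ hϖE hY, ← exp_neg, neg_neg]

/-! ## §2 M∕E-unramified letters (RamK ∕ Unr-K lanes) -/

/-- **THE CELL SCALAR IN THE M∕E-UNRAMIFIED LETTERS** (★ T5a∕T5b: `|α − ρα| = 1`, `|ϖE| = exp(−1)`, `Θ` isometric, `|Y| = |ϖE|^a`): `|ϖE^j · (α − ρα) · Θ Y| = exp(−(j + a))`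
(LH4-p19's `hccv ∕ hylev` product; the diagonal cell `a = j` ↦ `exp(−2j)`). [cite: Jacobowitz1962, §4] [cite: Serre1979, Ch. II §1] -/
theorem v_cellScalar_unr {α ϖE Y : K} (hα : Valued.v (α - ρ α) = 1)
    (hvΘ : ∀ x, Valued.v (Θ x) = Valued.v x) (hϖE : Valued.v ϖE = exp (-1 : ℤ))
    {j a : ℕ} (hY : Valued.v Y = Valued.v ϖE ^ a) :
    Valued.v (ϖE ^ j * (α - ρ α) * Θ Y) = exp (-((j : ℤ) + a)) := by
  rw [map_mul, map_mul, hvΘ, hY, map_pow, hα, mul_one, hϖE, ← exp_nsmul, ← exp_nsmul, ← exp_add]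
  congr 1
  simp only [nsmul_eq_mul]
  ring

/-- The same scalar on a presented member of an M∕E-unramified cone cell `levelSet ρ Θ α ϖE h j a`. [cite: Jacobowitz1962, §4] [cite: Kottwitz1986BaseChangeUnits, §1 pp. 240–241] -/
theorem v_cellScalar_dualGen_unr {α ϖE h x₀ : K} (hα : Valued.v (α - ρ α) = 1)
    (hvΘ : ∀ x, Valued.v (Θ x) = Valued.v x) (hϖE : Valued.v ϖE = exp (-1 : ℤ))
    {j a : ℕ} (hya : Valued.v (dualGen ρ Θ α (ϖE ^ j) h x₀) = Valued.v ϖE ^ a) :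
    Valued.v (ϖE ^ j * (α - ρ α) * Θ (dualGen ρ Θ α (ϖE ^ j) h x₀)) = exp (-((j : ℤ) + a)) :=
  v_cellScalar_unr hα hvΘ hϖE hya

/-- The inverse M∕E-unramified cell scalar: `|(ϖE^j · (α − ρα) · Θ Y)⁻¹| = exp(j + a)`. [cite: Jacobowitz1962, §4] [cite: Serre1979, Ch. II §1] -/
theorem v_cellScalar_inv_unr {α ϖE Y : K} (hα : Valued.v (α - ρ α) = 1)
    (hvΘ : ∀ x, Valued.v (Θ x) = Valued.v x) (hϖE : Valued.v ϖE = exp (-1 : ℤ))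
    {j a : ℕ} (hY : Valued.v Y = Valued.v ϖE ^ a) :
    Valued.v (ϖE ^ j * (α - ρ α) * Θ Y)⁻¹ = exp ((j : ℤ) + a) := by
  rw [map_inv₀, v_cellScalar_unr hα hvΘ hϖE hY, ← exp_neg, neg_neg]

end Summit.HodgeConjecture.HodgeConjecture.Cruxes.H413.F0P3cDyRamConeCellScaleDictionary

end
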